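import Literature.NumberTheory.IwasawaTheory.ClassicalMuVanishesImaginaryQuadraticTwoProofs
import Summits.BirchSwinnertonDyer.BirchSwinnertonDyer.Theorems.TwoAdicConverseOrdLambdaHalfAtTwoGreenbergGL1OfFW
import HarnessLib

/-!
# Crux `OrdLambdaHalfAtTwo` (stmt-BirchSwinnertonDyer-19556), line `kato_determinant_greenberg_two` v4.9: the print stub
# `stub_iqMuVanishesAtTwo` («`μ₂ = 0` for the cyclotomic `ℤ₂`-extension of every imaginary quadratic field») is a THEOREM

Prover seat `bsd-2adic-conv-1` GEN 33 (cell `bsd-2adic`; pen RC-450 key «FW-IQ-GENUS»), `--supports stmt-BirchSwinnertonDyer-19556`.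
The registered stub 3-IQ of the line skeleton (v4.9, replacing v4.8's [FW]-by-name `stub_residualGL1PrintFactsAtTwo`),
`∀ K imaginary quadratic, ∀ κK : ZpExtension K 2 cyclotomic, ClassicalMuVanishes κK`, is CLOSED BY NAME here from the Literature theorem
`Literature.NumberTheory.IwasawaTheory.classicalMuVanishes_imaginaryQuadratic_cyclotomic_two`, file `ClassicalMuVanishesImaginaryQuadraticTwoProofs` (Kida 1979 / Ferrero 1980 by genus theory:
Weber's odd `h⁺(ℚ_n)`, Okazaki's Lemma 17 on the CM fields `K·ℚ_n`, `t_n ≤ ∑_{ℓ ∣ d_K} ℓ²`, bounded `2`-ranks ⟹ `μ = 0` by the tree's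
finite-level Washington Prop. 13.23) — so every `…_of_FW` door of `TwoAdicConverseOrdLambdaHalfAtTwoGreenbergGL1OfFW` now holds
hypothesis-free: [P1] ∧ [P23] (`residualGL1PrintAtTwo_holds`) and GL1-res(K) (`residualGL1FinitenessAtTwo_holds`).

HONEST FRAMING.  This removes the last NAMED-FACT input of the residual `GL(1)` side of the line (Ferrero–Washington in general stays a named
fact and is no longer used); it proves nothing about the crux `OrdLambdaHalfAtTwo` itself (stub 6‴ `thetaShapiroGreenbergDivisibilityAtTwo`
is research and untouched, `stub_pub` / `stub_katoFinePrintBundleAtTwo` are print), and BSD is not proved by any of this.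
-/

set_option linter.dupNamespace false
set_option autoImplicit false

noncomputable section

open scoped Classical

namespace Summit.BirchSwinnertonDyer.BirchSwinnertonDyer.Theorems.TwoAdicGreenbergCotorsion

open NumberField IsDedekindDomain Field
open Literature Literature.NumberTheory.EllipticCurves Literature.NumberTheory.EllipticCurves.GreenbergSelmer
  Literature.NumberTheory.EllipticCurves.GreenbergVatsal2000 Literature.NumberTheory.GaloisRepresentations
  Literature.NumberTheory.IwasawaTheory
  Literature.NumberTheory.IwasawaTheory.ClassicalMuVanishesUnramifiedClasses
  Literature.NumberTheory.EllipticCurves.Rank1Residual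
  Summit.BirchSwinnertonDyer.Rank1Residual.X11b Summit.BirchSwinnertonDyer.Rank1Residual.X11b.AcSelmer
  Summit.BirchSwinnertonDyer.Rank1Residual.X2.ResidualDevissageModules

/-- **Stub 3-IQ of line `kato_determinant_greenberg_two` v4.9, CLOSED BY NAME (registered signature verbatim)**: for every imaginary quadratic
field `K` and every cyclotomic `ℤ₂`-extension `κK` of `K`, `μ(K_∞/K) = 0` in growth form — the Literature theorem
`classicalMuVanishes_imaginaryQuadratic_cyclotomic_two` (genus theory in the tower `K·ℚ_∞`). [cite: Kida1979Tohoku, Thm. 1]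
[cite: Ferrero1980AJM, Thm.] [cite: Washington1997, §13.3 Prop. 13.23] -/
theorem stub_iqMuVanishesAtTwo :
    ∀ (K : Type) [Field K] [NumberField K], IsImaginaryQuadratic K →
      ∀ (κK : ZpExtension K 2), κK.IsCyclotomic → Literature.NumberTheory.IwasawaTheory.ClassicalMuVanishes κK :=
  fun K _ _ hK κK hκK ↦ classicalMuVanishes_imaginaryQuadratic_cyclotomic_two K hK κK hκK

/-- **[P1] ∧ [P23] hypothesis-free** (v3.2's `stub_residualGL1PrintAtTwo`, binders verbatim): for an imaginary quadratic `K`, its cyclotomic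
`ℤ₂`-extension `κK` and any discrete `Γ_K`-module `M` of order `2`, the everywhere-unramified classes of `H¹(K_∞, M)` form a finite set and, for
every `v ∤ 2`, `H¹(K_∞, M)` modulo the classes unramified above `v` is finite — `residualGL1PrintAtTwo_of_classicalMuVanishes` fed by
`stub_iqMuVanishesAtTwo`. [cite: Lang1990, Ch. 5 §4 pp. 137–143] [cite: GreenbergVatsal2000, §2 Prop. (2.4)] [cite: Kida1979Tohoku, Thm. 1] -/
theorem residualGL1PrintAtTwo_holds :
    ∀ (K : Type) [Field K] [NumberField K], IsImaginaryQuadratic K →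
      ∀ (κK : ZpExtension K 2), κK.IsCyclotomic →
      ∀ (M : Type) [AddCommGroup M] [DistribMulAction (absoluteGaloisGroup K) M]
        [TopologicalSpace M] [DiscreteTopology M], Nat.card M = 2 →
        {c : Literature.NumberTheory.EllipticCurves.subgroupH1 κK.kerSubgroup M |
            ∀ (v : HeightOneSpectrum (𝓞 K)) (σ : absoluteGaloisGroup K),
            Literature.NumberTheory.EllipticCurves.conjH1 κK.kerSubgroup M σ c ∈ unramifiedKer κK.kerSubgroup M v}.Finite ∧
        ∀ (v : HeightOneSpectrum (𝓞 K)), ((2 : ℕ) : 𝓞 K) ∉ v.asIdeal →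
          Finite (Literature.NumberTheory.EllipticCurves.subgroupH1 κK.kerSubgroup M ⧸
            ⨅ σ : absoluteGaloisGroup K, (unramifiedKer κK.kerSubgroup M v).comap
              (Literature.NumberTheory.EllipticCurves.conjH1 κK.kerSubgroup M σ)) :=
  fun K _ _ hK κK hκ M _ _ _ _ hM2 ↦
    residualGL1PrintAtTwo_of_classicalMuVanishes hK κK hκ (stub_iqMuVanishesAtTwo K hK κK hκ) M hM2

/-- **GL1-res(K) hypothesis-free** (v2's `stub_residualGL1FinitenessAtTwo`, binders verbatim): for an imaginary quadratic `K`, its cyclotomic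
`ℤ₂`-extension, `w ∣ 2`, a finite `S` and a discrete `Γ_K`-module `M` of order `2`, the residual Greenberg–Castella Selmer group `R_w^S(K_∞, M)`
is finite — `residualGL1FinitenessAtTwo_of_classicalMuVanishes` fed by `stub_iqMuVanishesAtTwo`. [cite: Lang1990, Ch. 5 §4 pp. 137–143]
[cite: JaulentMaire2003, Thm 12 and Example p. 189] [cite: Kida1979Tohoku, Thm. 1] -/
theorem residualGL1FinitenessAtTwo_holds :
    ∀ (K : Type) [Field K] [NumberField K], IsImaginaryQuadratic K →
      ∀ (κK : ZpExtension K 2), κK.IsCyclotomic →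
      ∀ (w : HeightOneSpectrum (𝓞 K)), ((2 : ℕ) : 𝓞 K) ∈ w.asIdeal →
      ∀ (S : Set (HeightOneSpectrum (𝓞 K))), S.Finite →
      ∀ (M : Type) [AddCommGroup M] [DistribMulAction (absoluteGaloisGroup K) M]
        [TopologicalSpace M] [DiscreteTopology M], Nat.card M = 2 →
        (datumStrictSelmer κK.kerSubgroup M 2 (AcSelmer.bdpData M 2 w) S :
          Set (Literature.NumberTheory.EllipticCurves.subgroupH1 κK.kerSubgroup M)).Finite :=
  fun _ _ _ hK κK hκ w hw S hS M _ _ _ _ hM2 ↦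
    residualGL1FinitenessAtTwo_of_classicalMuVanishes hK κK hκ (stub_iqMuVanishesAtTwo _ hK κK hκ) w hw S hS M hM2

end Summit.BirchSwinnertonDyer.BirchSwinnertonDyer.Theorems.TwoAdicGreenbergCotorsion

end
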